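import Mathlib

/-!
# The CAUCHY–SCHWARZ form (CS) of ROW C-041 — the counting layer (p6, gen 28; mine-3's C-041.md §16–§17)

The CONJECTURE (CS) of C-041.md §16 reads, on a family of patterns with `v` valid, `x` Good₁ and `y` Good₂ ones,
`(v − x − y)₊² ≤ x·y`; in `ℕ` the truncated subtraction is the positive part, so `CS v x y := (v - x - y)^2 ≤ x * y`.
This file is the arithmetic used by every (CS) argument of the row, with no square roots:

* `cs_of_le` — `v ≤ x + y` gives (CS);
* **`cs_add`** — the two-term CAUCHY–SCHWARZ step: `c² ≤ ab` and `c′² ≤ a′b′` give `(c + c′)² ≤ (a + a′)(b + b′)`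
  (`2cc′ ≤ ab′ + a′b` because `(2cc′)² ≤ 4(ab)(a′b′) ≤ (ab′ + a′b)²`); **`cs_sum`** — the same over any finite family
  (mine-3's closure property (U), disjoint unions);
* `sum_tsub_le_sum_tsub`, `tsub_tsub_sum_le` — truncated subtraction is subadditive over sums, so
  **`cs_of_fibres`**: if every fibre of a partition satisfies (CS), so does the whole;
* **`cs_mono`** — the closure property (M): (CS) for `(v₀, x₀, y₀)` transfers to `(v, x, y)` when `x₀ ≤ x`,
  `y₀ ≤ y` and `v − x − y ≤ v₀ − x₀ − y₀`;
* **`two_mul_le_of_cs`** — the AM–GM corollary `2v ≤ 3x + 3y`, i.e. (CS) implies the weight inequality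
  `Σ[valid](3·G₁ + 3·G₂ − 2) ≥ 0` of THEOREM R / the O-cube (`4xy ≤ (x + y)²`);
* `cs_comm` — (CS) is symmetric in the two Good counts.
-/

namespace PercRepro

namespace CSCount

/-- The (CS) predicate on a triple of counts (valid, Good₁, Good₂): `(v − x − y)₊² ≤ x·y`, the truncated
subtraction of `ℕ` being the positive part. -/
def CS (v x y : ℕ) : Prop := (v - x - y) ^ 2 ≤ x * y

/-- (CS) is symmetric in the two Good counts. -/
theorem cs_comm {v x y : ℕ} (h : CS v x y) : CS v y x := by
  unfold CS at h ⊢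
  have e : v - y - x = v - x - y := by omega
  rw [e, mul_comm]
  exact h

/-- `v ≤ x + y` gives (CS). -/
theorem cs_of_le {v x y : ℕ} (h : v ≤ x + y) : CS v x y := by
  unfold CS
  have e : v - x - y = 0 := by omega
  rw [e]
  exact Nat.zero_le _

/-- A square root of a product of two squares: `(cc′)² ≤ (ab)(a′b′)`. -/
theorem sq_mul_le {a b c a' b' c' : ℕ} (h : c ^ 2 ≤ a * b) (h' : c' ^ 2 ≤ a' * b') :
    (c * c') ^ 2 ≤ (a * b) * (a' * b') := by
  calc (c * c') ^ 2 = c ^ 2 * c' ^ 2 := by ring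
    _ ≤ (a * b) * (a' * b') := Nat.mul_le_mul h h'

/-- The cross term: `2cc′ ≤ ab′ + a′b` when `c² ≤ ab` and `c′² ≤ a′b′`. -/
theorem two_mul_cross_le {a b c a' b' c' : ℕ} (h : c ^ 2 ≤ a * b) (h' : c' ^ 2 ≤ a' * b') :
    2 * (c * c') ≤ a * b' + a' * b := by
  have h1 := sq_mul_le h h'
  have h2 : 2 * (a * b') * (a' * b) ≤ (a * b') ^ 2 + (a' * b) ^ 2 := two_mul_le_add_sq _ _
  have h3 : (2 * (c * c')) ^ 2 ≤ (a * b' + a' * b) ^ 2 := by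
    calc (2 * (c * c')) ^ 2 = 4 * (c * c') ^ 2 := by ring
      _ ≤ 4 * ((a * b) * (a' * b')) := Nat.mul_le_mul_left 4 h1
      _ = 2 * (a * b') * (a' * b) + 2 * (a * b') * (a' * b) := by ring
      _ ≤ 2 * (a * b') * (a' * b) + ((a * b') ^ 2 + (a' * b) ^ 2) := Nat.add_le_add_left h2 _
      _ = (a * b' + a' * b) ^ 2 := by ring
  exact (Nat.pow_le_pow_iff_left (by norm_num : (2 : ℕ) ≠ 0)).1 h3

/-- **The two-term CAUCHY–SCHWARZ step in `ℕ`**: `c² ≤ ab` and `c′² ≤ a′b′` give `(c + c′)² ≤ (a + a′)(b + b′)`. -/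
theorem cs_add {a b c a' b' c' : ℕ} (h : c ^ 2 ≤ a * b) (h' : c' ^ 2 ≤ a' * b') :
    (c + c') ^ 2 ≤ (a + a') * (b + b') := by
  have key := two_mul_cross_le h h'
  calc (c + c') ^ 2 = c ^ 2 + 2 * (c * c') + c' ^ 2 := by ring
    _ ≤ a * b + (a * b' + a' * b) + a' * b' := by linarith
    _ = (a + a') * (b + b') := by ring

/-- **(U), CAUCHY–SCHWARZ over a finite family**: `c_i² ≤ a_i·b_i` for every `i` gives
`(Σ c_i)² ≤ (Σ a_i)·(Σ b_i)`. -/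
theorem cs_sum {ι : Type*} (s : Finset ι) (a b c : ι → ℕ) (h : ∀ i ∈ s, c i ^ 2 ≤ a i * b i) :
    (∑ i ∈ s, c i) ^ 2 ≤ (∑ i ∈ s, a i) * (∑ i ∈ s, b i) := by
  classical
  induction s using Finset.induction_on with
  | empty => simp
  | insert j s hj ih =>
    rw [Finset.sum_insert hj, Finset.sum_insert hj, Finset.sum_insert hj]
    exact cs_add (h j (Finset.mem_insert_self j s)) (ih fun i hi => h i (Finset.mem_insert_of_mem hi))

/-- Truncated subtraction is subadditive over sums. -/
theorem sum_tsub_le_sum_tsub {ι : Type*} (s : Finset ι) (f g : ι → ℕ) :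
    (∑ i ∈ s, f i) - (∑ i ∈ s, g i) ≤ ∑ i ∈ s, (f i - g i) := by
  apply Nat.sub_le_of_le_add
  rw [← Finset.sum_add_distrib]
  exact Finset.sum_le_sum fun i _ => by omega

/-- Twice-truncated subtraction is subadditive over sums. -/
theorem tsub_tsub_sum_le {ι : Type*} (s : Finset ι) (v x y : ι → ℕ) :
    (∑ i ∈ s, v i) - (∑ i ∈ s, x i) - (∑ i ∈ s, y i) ≤ ∑ i ∈ s, (v i - x i - y i) :=
  calc (∑ i ∈ s, v i) - (∑ i ∈ s, x i) - (∑ i ∈ s, y i)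
      ≤ (∑ i ∈ s, (v i - x i)) - (∑ i ∈ s, y i) := Nat.sub_le_sub_right (sum_tsub_le_sum_tsub s v x) _
    _ ≤ ∑ i ∈ s, (v i - x i - y i) := sum_tsub_le_sum_tsub s (fun i => v i - x i) y

/-- **(CS) fibre by fibre**: if every fibre of a partition of the patterns satisfies (CS), so does the whole. -/
theorem cs_of_fibres {ι : Type*} (s : Finset ι) (v x y : ι → ℕ) (h : ∀ i ∈ s, CS (v i) (x i) (y i)) :
    CS (∑ i ∈ s, v i) (∑ i ∈ s, x i) (∑ i ∈ s, y i) := by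
  unfold CS at h ⊢
  calc ((∑ i ∈ s, v i) - (∑ i ∈ s, x i) - (∑ i ∈ s, y i)) ^ 2
      ≤ (∑ i ∈ s, (v i - x i - y i)) ^ 2 := Nat.pow_le_pow_left (tsub_tsub_sum_le s v x y) 2
    _ ≤ (∑ i ∈ s, x i) * (∑ i ∈ s, y i) := cs_sum s x y (fun i => v i - x i - y i) h

/-- **(M), monotonicity**: (CS) for `(v₀, x₀, y₀)` transfers to `(v, x, y)` when the Good counts do not decrease and
the excess `v − x − y` does not increase. -/
theorem cs_mono {v x y v₀ x₀ y₀ : ℕ} (h : CS v₀ x₀ y₀) (hx : x₀ ≤ x) (hy : y₀ ≤ y)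
    (hv : v - x - y ≤ v₀ - x₀ - y₀) : CS v x y := by
  unfold CS at h ⊢
  calc (v - x - y) ^ 2 ≤ (v₀ - x₀ - y₀) ^ 2 := Nat.pow_le_pow_left hv 2
    _ ≤ x₀ * y₀ := h
    _ ≤ x * y := Nat.mul_le_mul hx hy

/-- **The AM–GM corollary of (CS)**: `2v ≤ 3x + 3y`, i.e. the weight sum `Σ[valid](3·G₁ + 3·G₂ − 2)` is
nonnegative (`4xy ≤ (x + y)²`). -/
theorem two_mul_le_of_cs {v x y : ℕ} (h : CS v x y) : 2 * v ≤ 3 * x + 3 * y := by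
  unfold CS at h
  by_cases hv : v ≤ x + y
  · omega
  have h2 : 2 * x * y ≤ x ^ 2 + y ^ 2 := two_mul_le_add_sq x y
  have h3 : (2 * (v - x - y)) ^ 2 ≤ (x + y) ^ 2 := by
    calc (2 * (v - x - y)) ^ 2 = 4 * (v - x - y) ^ 2 := by ring
      _ ≤ 4 * (x * y) := Nat.mul_le_mul_left 4 h
      _ = 2 * x * y + 2 * x * y := by ring
      _ ≤ 2 * x * y + (x ^ 2 + y ^ 2) := Nat.add_le_add_left h2 _
      _ = (x + y) ^ 2 := by ring
  have h4 : 2 * (v - x - y) ≤ x + y := (Nat.pow_le_pow_iff_left (by norm_num : (2 : ℕ) ≠ 0)).1 h3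
  omega

end CSCount

end PercRepro
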